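import Mathlib
import HarnessLib
import Summits.KontsevichZagierPeriods.KontsevichZagierPeriods.Theses.LinRedNormalForm
import Summits.KontsevichZagierPeriods.KontsevichZagierPeriods.Theorems.LinRedNormalFormDihedralNormalFormStubUnnestingThreeAux1
import Summits.KontsevichZagierPeriods.KontsevichZagierPeriods.Theorems.LinRedNormalFormDihedralNormalFormStubNonSimpleReductionAux5
import Summits.KontsevichZagierPeriods.KontsevichZagierPeriods.Theorems.LinRedNormalFormDihedralNormalFormStubNonSimpleReductionAux6

/-!
# `DihedralNormalForm`, line `torus-descent-sum-shadow`: unnesting in dimension three (the stub)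

The stub `stub_unnesting_three` of the crux `DihedralNormalForm` (stmt-KontsevichZagierPeriods-3912,
route `LinRedNormalForm`): the residual stub `stub_unnesting` in dimension `k = 3`, and
`stub_unnesting_le_three` (all `k ≤ 3`; vacuous for `k ≤ 2`). THEOREM: every cubical atom
`[□³, q·atomFun a e]` is congruent modulo `KZ.relations` to a `ℤ`-combination of NESTED dimension-three
atoms (a fortiori to an element of the stub's target closure). Algorithm (all moves rule 1b in the
fixed cube chart, every piece dominated by its parent, plus one dihedral move per leaf; no rule 3, no
dissection, no dimension drop):
* `e₀₁ ≥ 1`: `y₀₁ = y₀ + x₀y₁` lowers `e₀₁` in both pieces (leaves `e₀₁ = 0`); `e₁₂ ≥ 1` likewise;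
* `e₀₁, e₁₂ ≤ -1`: with `g₄ = a₁ - a₀ - e₀₀ - 1`, `g₁ = a₁ - a₂ - e₂₂ - 1`: `g₄ > 0`: `x₀ + y₀ = 1`
  lowers `g₄`; `g₁ > 0 > g₄`: `x₂ + y₂ = 1` lowers `g₁`; `g₄, g₁ < 0`: `x₁x₂ + y₁₂ = 1` raises `g₄` in
  one piece and `e₁₂` in the other; leaves `g₄ = 0`, `g₁ = 0` and `e₁₂ = 0`.
The leaves are the atoms NESTED in some dihedral chart: `e₀₁ = 0`, `e₁₂ = 0` (nested as they stand),
`a₁ = a₂ + e₂₂ + 1` (the reflection `dihedralReflection` has `e'₀₁ = a₁ - a₂ - 1 - e₂₂ = 0`),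
`a₁ = a₀ + e₀₀ + 1` (reversal `atomReversal`, then the reflection). Tools: `…StubUnnestingThreeAux1`.

References: M. Kontsevich, D. Zagier, *Periods* (2001), §1.2; F. Brown, *Multiple zeta values and
periods of moduli spaces* (2009), §2 (dihedral symmetry of the cell).
-/

noncomputable section

open MeasureTheory Set
open Literature.ModelTheory.ExponentialFields (IsSemialgebraic)

namespace Summit.KontsevichZagierPeriods.DihedralNormalForm.TorusDescent

open Literature.NumberTheory.Transcendental
open Literature.ModelTheory.ExponentialFields

/-! ### Nestedness in dimension three -/

/-- In dimension three, an exponent matrix with `e 0 1 = 0` is nested. [folklore] -/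
theorem nested_three_of_e01 (e : Fin 3 → Fin 3 → ℤ) (h : e 0 1 = 0) :
    ∀ i j i' j' : Fin 3, i < j → i' < j' → e i j ≠ 0 → e i' j' ≠ 0 →
      (i ≤ i' ∧ j' ≤ j) ∨ (i' ≤ i ∧ j ≤ j') := by
  intro i j i' j' hij hij' h1 h2
  fin_cases i <;> fin_cases j <;> simp at hij <;> fin_cases i' <;> fin_cases j' <;> simp at hij' <;>
    first | decide | exact absurd h h1 | exact absurd h h2

/-- In dimension three, an exponent matrix with `e 1 2 = 0` is nested. [folklore] -/
theorem nested_three_of_e12 (e : Fin 3 → Fin 3 → ℤ) (h : e 1 2 = 0) :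
    ∀ i j i' j' : Fin 3, i < j → i' < j' → e i j ≠ 0 → e i' j' ≠ 0 →
      (i ≤ i' ∧ j' ≤ j) ∨ (i' ≤ i ∧ j ≤ j') := by
  intro i j i' j' hij hij' h1 h2
  fin_cases i <;> fin_cases j <;> simp at hij <;> fin_cases i' <;> fin_cases j' <;> simp at hij' <;>
    first | decide | exact absurd h h1 | exact absurd h h2

/-! ### Leaves -/

/-- A cube atom with `e₀₁ = 0` or `e₁₂ = 0` is a nested dimension-three atom. [folklore] -/
theorem leaf_nested_three (q : ℚ) (a : Fin 3 → ℕ) (e : Fin 3 → Fin 3 → ℤ) (s : KZ.IntegralRep 3) :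
    s.domain = {x : Fin 3 → ℝ | ∀ i, x i ∈ Set.Ioo (0:ℝ) 1} →
    Set.EqOn s.integrand (fun x => (q : ℝ) * atomFun a e x) s.domain → (e 0 1 = 0 ∨ e 1 2 = 0) →
    ∃ m ∈ AddSubgroup.closure {z : Literature.NumberTheory.Transcendental.KZ.FormalRep | ∃ (q : ℚ) (a : Fin 3 → ℕ) (e : Fin 3 → Fin 3 → ℤ) (s : Literature.NumberTheory.Transcendental.KZ.IntegralRep 3), (∀ i j i' j' : Fin 3, i < j → i' < j' → e i j ≠ 0 → e i' j' ≠ 0 → (i ≤ i' ∧ j' ≤ j) ∨ (i' ≤ i ∧ j ≤ j')) ∧ s.domain = {x : Fin 3 → ℝ | ∀ i, x i ∈ Set.Ioo (0:ℝ) 1} ∧ Set.EqOn s.integrand (fun x => (q : ℝ) * ((∏ i : Fin 3, x i ^ a i) * ∏ i : Fin 3, ∏ j : Fin 3, if i ≤ j then (1 - (∏ l : Fin 3, if i ≤ l ∧ l ≤ j then x l else 1)) ^ e i j else 1)) s.domain ∧ z = Literature.NumberTheory.Transcendental.KZ.of s}, Literature.NumberTheory.Transcendental.KZ.of s - m ∈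 Literature.NumberTheory.Transcendental.KZ.relations := by
  intro hdom hint h
  refine ⟨KZ.of s, AddSubgroup.subset_closure ⟨q, a, e, s, ?_, hdom, hint, rfl⟩, by simp [KZ.relations.zero_mem]⟩
  rcases h with h | h
  · exact nested_three_of_e01 e h
  · exact nested_three_of_e12 e h

/-- The zero atom is a relation. [folklore] -/
theorem leaf_zero_three (a : Fin 3 → ℕ) (e : Fin 3 → Fin 3 → ℤ) (s : KZ.IntegralRep 3)
    (hint : Set.EqOn s.integrand (fun x => ((0 : ℚ) : ℝ) * atomFun a e x) s.domain) :
    ∃ m ∈ AddSubgroup.closure {z : Literature.NumberTheory.Transcendental.KZ.FormalRep | ∃ (q : ℚ) (a : Fin 3 → ℕ) (e : Fin 3 → Fin 3 → ℤ) (s : Literature.NumberTheory.Transcendental.KZ.IntegralRep 3), (∀ i j i' j' : Fin 3, i < j → i' < j' → e i j ≠ 0 → e i' j' ≠ 0 → (i ≤ i' ∧ j' ≤ j) ∨ (i' ≤ i ∧ j ≤ j')) ∧ s.domain = {x : Fin 3 → ℝ | ∀ i, x i ∈ Set.Ioo (0:ℝ) 1} ∧ Set.EqOn s.integrand (fun x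 => (q : ℝ) * ((∏ i : Fin 3, x i ^ a i) * ∏ i : Fin 3, ∏ j : Fin 3, if i ≤ j then (1 - (∏ l : Fin 3, if i ≤ l ∧ l ≤ j then x l else 1)) ^ e i j else 1)) s.domain ∧ z = Literature.NumberTheory.Transcendental.KZ.of s}, Literature.NumberTheory.Transcendental.KZ.of s - m ∈ Literature.NumberTheory.Transcendental.KZ.relations := by
  refine ⟨0, zero_mem _, ?_⟩
  rw [sub_zero]
  exact KZ.of_mem_relations_of_eqOn_zero s fun x hx => by simp [hint hx]

/-- The `(0,1)` entry of the reflected exponent matrix of `dihedralReflection` in dimension three is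
`a₁ - a₂ - 1 - e₂₂`. [folklore] -/
theorem reflected_e01_three (a : Fin 3 → ℕ) (e : Fin 3 → Fin 3 → ℤ) :
    ((∑ l : Fin 3, if (l : ℕ) + 1 + ((1 : Fin 3) : ℕ) = 3 then (a l : ℤ) else 0) -
      (∑ l : Fin 3, if (l : ℕ) + ((1 : Fin 3) : ℕ) = 3 then (a l : ℤ) + 1 else 0) -
      ∑ i' : Fin 3, ∑ j' : Fin 3, if (i' : ℕ) + ((1 : Fin 3) : ℕ) = 3 ∧ i' ≤ j' then e i' j' else 0) =
      (a 1 : ℤ) - a 2 - 1 - e 2 2 := by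
  simp [Fin.sum_univ_three]
  ring

/-- **Leaf `a₁ = a₂ + e₂₂ + 1`.** Such a cube atom is congruent, by one dihedral reflection, to a
nested atom. [cite: KontsevichZagier2001, §1.2 rule (2)] -/
theorem leaf_H1_three (q : ℚ) (hq : q ≠ 0) (a : Fin 3 → ℕ) (e : Fin 3 → Fin 3 → ℤ)
    (s : KZ.IntegralRep 3) :
    s.domain = {x : Fin 3 → ℝ | ∀ i, x i ∈ Set.Ioo (0:ℝ) 1} →
    Set.EqOn s.integrand (fun x => (q : ℝ) * atomFun a e x) s.domain → (a 1 : ℤ) = a 2 + e 2 2 + 1 →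
    ∃ m ∈ AddSubgroup.closure {z : Literature.NumberTheory.Transcendental.KZ.FormalRep | ∃ (q : ℚ) (a : Fin 3 → ℕ) (e : Fin 3 → Fin 3 → ℤ) (s : Literature.NumberTheory.Transcendental.KZ.IntegralRep 3), (∀ i j i' j' : Fin 3, i < j → i' < j' → e i j ≠ 0 → e i' j' ≠ 0 → (i ≤ i' ∧ j' ≤ j) ∨ (i' ≤ i ∧ j ≤ j')) ∧ s.domain = {x : Fin 3 → ℝ | ∀ i, x i ∈ Set.Ioo (0:ℝ) 1} ∧ Set.EqOn s.integrand (fun x => (q : ℝ) * ((∏ i : Fin 3, x i ^ a i) * ∏ i : Fin 3, ∏ j : Fin 3, if i ≤ j then (1 - (∏ l : Fin 3, if i ≤ l ∧ l ≤ j then x l else 1)) ^ e i j else 1)) s.domain ∧ z = Literature.NumberTheory.Transcendental.KZ.of s}, Literature.NumberTheory.Transcendental.KZ.of s - m ∈ Literature.NumberTheory.Transcendental.KZ.relations := by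
  intro hdom hint h
  obtain ⟨a', s', -, hdom', hint', hrel⟩ := dihedralReflection 3 q a e s hq hdom hint
  refine ⟨KZ.of s', AddSubgroup.subset_closure ⟨q, a', _, s', ?_, hdom', hint', rfl⟩, hrel⟩
  refine nested_three_of_e01 _ ?_
  have h01 : (((0 : Fin 3) : ℕ) = 0) := rfl
  rw [if_pos h01, reflected_e01_three]
  omega

/-- **Leaf `a₁ = a₀ + e₀₀ + 1`.** Such a cube atom is congruent, by the coordinate reversal followed by
one dihedral reflection, to a nested atom. [cite: KontsevichZagier2001, §1.2 rule (2)] -/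
theorem leaf_H4_three (q : ℚ) (hq : q ≠ 0) (a : Fin 3 → ℕ) (e : Fin 3 → Fin 3 → ℤ)
    (s : KZ.IntegralRep 3) :
    s.domain = {x : Fin 3 → ℝ | ∀ i, x i ∈ Set.Ioo (0:ℝ) 1} →
    Set.EqOn s.integrand (fun x => (q : ℝ) * atomFun a e x) s.domain → (a 1 : ℤ) = a 0 + e 0 0 + 1 →
    ∃ m ∈ AddSubgroup.closure {z : Literature.NumberTheory.Transcendental.KZ.FormalRep | ∃ (q : ℚ) (a : Fin 3 → ℕ) (e : Fin 3 → Fin 3 → ℤ) (s : Literature.NumberTheory.Transcendental.KZ.IntegralRep 3), (∀ i j i' j' : Fin 3, i < j → i' < j' → e i j ≠ 0 → e i' j' ≠ 0 → (i ≤ i' ∧ j' ≤ j) ∨ (i' ≤ i ∧ j ≤ j')) ∧ s.domain = {x : Fin 3 → ℝ | ∀ i, x i ∈ Set.Ioo (0:ℝ) 1} ∧ Set.EqOn s.integrand (fun x => (q : ℝ) * ((∏ i : Fin 3, x i ^ a i) * ∏ i : Fin 3, ∏ j : Fin 3, if i ≤ j then (1 - (∏ l : Fin 3, if i ≤ l ∧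 l ≤ j then x l else 1)) ^ e i j else 1)) s.domain ∧ z = Literature.NumberTheory.Transcendental.KZ.of s}, Literature.NumberTheory.Transcendental.KZ.of s - m ∈ Literature.NumberTheory.Transcendental.KZ.relations := by
  intro hdom hint h
  obtain ⟨s', hdom', hint', hrel⟩ := atomReversal 3 q a e s hdom hint
  have hr0 : Fin.rev (0 : Fin 3) = 2 := rfl
  have hr1 : Fin.rev (1 : Fin 3) = 1 := rfl
  have hr2 : Fin.rev (2 : Fin 3) = 0 := rfl
  have hH1 : ((fun i => a (Fin.rev i)) 1 : ℤ) =
      (fun i => a (Fin.rev i)) 2 + (fun i j => e (Fin.rev j) (Fin.rev i)) 2 2 + 1 := by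
    simp only [hr1, hr2]
    exact h
  obtain ⟨m, hm, hrel'⟩ := leaf_H1_three q hq (fun i => a (Fin.rev i))
    (fun i j => e (Fin.rev j) (Fin.rev i)) s' hdom' hint' hH1
  refine ⟨m, hm, ?_⟩
  have : KZ.of s - m = (KZ.of s - KZ.of s') + (KZ.of s' - m) := by abel
  rw [this]
  exact KZ.relations.add_mem hrel hrel'

/-- Combining the reductions of the two pieces of a split. [folklore] -/
theorem combine_pieces_three {s s₁ s₂ : KZ.IntegralRep 3} {m₁ m₂ : KZ.FormalRep}
    {N : AddSubgroup KZ.FormalRep}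
    (h : KZ.of s - KZ.of s₁ - KZ.of s₂ ∈ KZ.relations) (h₁m : m₁ ∈ N) (h₂m : m₂ ∈ N)
    (h₁ : KZ.of s₁ - m₁ ∈ KZ.relations) (h₂ : KZ.of s₂ - m₂ ∈ KZ.relations) :
    ∃ m ∈ N, KZ.of s - m ∈ KZ.relations := by
  refine ⟨m₁ + m₂, add_mem h₁m h₂m, ?_⟩
  have : KZ.of s - (m₁ + m₂) =
      (KZ.of s - KZ.of s₁ - KZ.of s₂) + (KZ.of s₁ - m₁) + (KZ.of s₂ - m₂) := by abel
  rw [this]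
  exact KZ.relations.add_mem (KZ.relations.add_mem h h₁) h₂

/-! ### Phase N: a numerator crossing chord -/

/-- `e₀₁ ≥ 0`: binomial expansion `y₀₁ = y₀ + x₀y₁` down to `e₀₁ = 0`. [folklore] -/
theorem unnest_three_N (q : ℚ) : ∀ (n : ℕ) (a : Fin 3 → ℕ) (e : Fin 3 → Fin 3 → ℤ)
    (s : KZ.IntegralRep 3),
    s.domain = {x : Fin 3 → ℝ | ∀ i, x i ∈ Set.Ioo (0:ℝ) 1} →
    Set.EqOn s.integrand (fun x => (q : ℝ) * atomFun a e x) s.domain → 0 ≤ e 0 1 → e 0 1 ≤ n →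
    ∃ m ∈ AddSubgroup.closure {z : Literature.NumberTheory.Transcendental.KZ.FormalRep | ∃ (q : ℚ) (a : Fin 3 → ℕ) (e : Fin 3 → Fin 3 → ℤ) (s : Literature.NumberTheory.Transcendental.KZ.IntegralRep 3), (∀ i j i' j' : Fin 3, i < j → i' < j' → e i j ≠ 0 → e i' j' ≠ 0 → (i ≤ i' ∧ j' ≤ j) ∨ (i' ≤ i ∧ j ≤ j')) ∧ s.domain = {x : Fin 3 → ℝ | ∀ i, x i ∈ Set.Ioo (0:ℝ) 1} ∧ Set.EqOn s.integrand (fun x => (q : ℝ) * ((∏ i : Fin 3, x i ^ a i) * ∏ i : Fin 3, ∏ j : Fin 3, if i ≤ j then (1 - (∏ l : Fin 3, if i ≤ l ∧ l ≤ j then x l else 1)) ^ e i j else 1)) s.domain ∧ z = Literature.NumberTheory.Transcendental.KZ.of s}, Literature.NumberTheory.Transcendental.KZ.of s - m ∈ Literature.NumberTheory.Transcendental.KZ.relations := by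
  intro n
  induction n with
  | zero =>
    intro a e s hdom hint h0 hn
    exact leaf_nested_three q a e s hdom hint (Or.inl (by omega))
  | succ n ih =>
    intro a e s hdom hint h0 hn
    by_cases h : e 0 1 = 0
    · exact leaf_nested_three q a e s hdom hint (Or.inl h)
    · obtain ⟨s₁, s₂, ⟨hd₁, hi₁⟩, ⟨hd₂, hi₂⟩, hrel⟩ := atomMove_n01 (q := q) ⟨hdom, hint⟩
      obtain ⟨m₁, hm₁, h₁⟩ := ih a (fun i j => e i j + (if i = 0 ∧ j = 0 then 1 else if i = 0 ∧ j = 1 then -1 else 0)) s₁ hd₁ hi₁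
        (by simp; omega) (by simp; omega)
      obtain ⟨m₂, hm₂, h₂⟩ := ih (fun i => a i + (if i = 0 then 1 else 0)) (fun i j => e i j + (if i = 1 ∧ j = 1 then 1 else if i = 0 ∧ j = 1 then -1 else 0)) s₂ hd₂ hi₂
        (by simp; omega) (by simp; omega)
      exact combine_pieces_three hrel hm₁ hm₂ h₁ h₂

/-- `e₁₂ ≥ 0`: binomial expansion `y₁₂ = y₂ + x₂y₁` down to `e₁₂ = 0`. [folklore] -/
theorem unnest_three_N' (q : ℚ) : ∀ (n : ℕ) (a : Fin 3 → ℕ) (e : Fin 3 → Fin 3 → ℤ)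
    (s : KZ.IntegralRep 3),
    s.domain = {x : Fin 3 → ℝ | ∀ i, x i ∈ Set.Ioo (0:ℝ) 1} →
    Set.EqOn s.integrand (fun x => (q : ℝ) * atomFun a e x) s.domain → 0 ≤ e 1 2 → e 1 2 ≤ n →
    ∃ m ∈ AddSubgroup.closure {z : Literature.NumberTheory.Transcendental.KZ.FormalRep | ∃ (q : ℚ) (a : Fin 3 → ℕ) (e : Fin 3 → Fin 3 → ℤ) (s : Literature.NumberTheory.Transcendental.KZ.IntegralRep 3), (∀ i j i' j' : Fin 3, i < j → i' < j' → e i j ≠ 0 → e i' j' ≠ 0 → (i ≤ i' ∧ j' ≤ j) ∨ (i' ≤ i ∧ j ≤ j')) ∧ s.domain = {x : Fin 3 → ℝ | ∀ i, x i ∈ Set.Ioo (0:ℝ) 1} ∧ Set.EqOn s.integrand (fun x => (q : ℝ) * ((∏ i : Fin 3, x i ^ a i) * ∏ i : Fin 3, ∏ j : Fin 3, if i ≤ j then (1 - (∏ l : Fin 3, if i ≤ l ∧ l ≤ j then x l else 1)) ^ e i j else 1)) s.domain ∧ z = Literature.NumberTheory.Transcendental.KZ.of s}, Literature.NumberTheory.Transcendental.KZ.of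 s - m ∈ Literature.NumberTheory.Transcendental.KZ.relations := by
  intro n
  induction n with
  | zero =>
    intro a e s hdom hint h0 hn
    exact leaf_nested_three q a e s hdom hint (Or.inr (by omega))
  | succ n ih =>
    intro a e s hdom hint h0 hn
    by_cases h : e 1 2 = 0
    · exact leaf_nested_three q a e s hdom hint (Or.inr h)
    · obtain ⟨s₁, s₂, ⟨hd₁, hi₁⟩, ⟨hd₂, hi₂⟩, hrel⟩ := atomMove_n12 (q := q) ⟨hdom, hint⟩
      obtain ⟨m₁, hm₁, h₁⟩ := ih a (fun i j => e i j + (if i = 2 ∧ j = 2 then 1 else if i = 1 ∧ j = 2 then -1 else 0)) s₁ hd₁ hi₁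
        (by simp; omega) (by simp; omega)
      obtain ⟨m₂, hm₂, h₂⟩ := ih (fun i => a i + (if i = 2 then 1 else 0)) (fun i j => e i j + (if i = 1 ∧ j = 1 then 1 else if i = 1 ∧ j = 2 then -1 else 0)) s₂ hd₂ hi₂
        (by simp; omega) (by simp; omega)
      exact combine_pieces_three hrel hm₁ hm₂ h₁ h₂

/-! ### Phase D: both crossing chords in the denominator -/

/-- `g₄ = a₁ - a₀ - e₀₀ - 1 ≥ 0`: `x₀ + y₀ = 1` down to `g₄ = 0`. [folklore] -/
theorem unnest_three_D1 (q : ℚ) (hq : q ≠ 0) : ∀ (n : ℕ) (a : Fin 3 → ℕ) (e : Fin 3 → Fin 3 → ℤ)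
    (s : KZ.IntegralRep 3),
    s.domain = {x : Fin 3 → ℝ | ∀ i, x i ∈ Set.Ioo (0:ℝ) 1} →
    Set.EqOn s.integrand (fun x => (q : ℝ) * atomFun a e x) s.domain → 0 ≤ (a 1 : ℤ) - a 0 - e 0 0 - 1 → (a 1 : ℤ) - a 0 - e 0 0 - 1 ≤ n →
    ∃ m ∈ AddSubgroup.closure {z : Literature.NumberTheory.Transcendental.KZ.FormalRep | ∃ (q : ℚ) (a : Fin 3 → ℕ) (e : Fin 3 → Fin 3 → ℤ) (s : Literature.NumberTheory.Transcendental.KZ.IntegralRep 3), (∀ i j i' j' : Fin 3, i < j → i' < j' → e i j ≠ 0 → e i' j' ≠ 0 → (i ≤ i' ∧ j' ≤ j) ∨ (i' ≤ i ∧ j ≤ j')) ∧ s.domain = {x : Fin 3 → ℝ | ∀ i, x i ∈ Set.Ioo (0:ℝ) 1} ∧ Set.EqOn s.integrand (fun x => (q : ℝ) * ((∏ i : Fin 3, x i ^ a i) * ∏ i : Fin 3, ∏ j : Fin 3, if i ≤ j then (1 - (∏ l : Fin 3, if i ≤ l ∧ l ≤ j then x l else 1)) ^ e i j else 1)) s.domain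 ∧ z = Literature.NumberTheory.Transcendental.KZ.of s}, Literature.NumberTheory.Transcendental.KZ.of s - m ∈ Literature.NumberTheory.Transcendental.KZ.relations := by
  intro n
  induction n with
  | zero =>
    intro a e s hdom hint h0 hn
    exact leaf_H4_three q hq a e s hdom hint (by omega)
  | succ n ih =>
    intro a e s hdom hint h0 hn
    by_cases h : (a 1 : ℤ) - a 0 - e 0 0 - 1 = 0
    · exact leaf_H4_three q hq a e s hdom hint (by omega)
    · obtain ⟨s₁, s₂, ⟨hd₁, hi₁⟩, ⟨hd₂, hi₂⟩, hrel⟩ := atomMove_s00 (q := q) ⟨hdom, hint⟩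
      obtain ⟨m₁, hm₁, h₁⟩ := ih (fun i => a i + (if i = 0 then 1 else 0)) e s₁ hd₁ hi₁
        (by simp; omega) (by simp; omega)
      obtain ⟨m₂, hm₂, h₂⟩ := ih a (fun i j => e i j + (if i = 0 ∧ j = 0 then 1 else 0)) s₂ hd₂ hi₂
        (by simp; omega) (by simp; omega)
      exact combine_pieces_three hrel hm₁ hm₂ h₁ h₂

/-- `g₁ = a₁ - a₂ - e₂₂ - 1 ≥ 0`: `x₂ + y₂ = 1` down to `g₁ = 0`. [folklore] -/
theorem unnest_three_D2 (q : ℚ) (hq : q ≠ 0) : ∀ (n : ℕ) (a : Fin 3 → ℕ) (e : Fin 3 → Fin 3 → ℤ)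
    (s : KZ.IntegralRep 3),
    s.domain = {x : Fin 3 → ℝ | ∀ i, x i ∈ Set.Ioo (0:ℝ) 1} →
    Set.EqOn s.integrand (fun x => (q : ℝ) * atomFun a e x) s.domain → 0 ≤ (a 1 : ℤ) - a 2 - e 2 2 - 1 → (a 1 : ℤ) - a 2 - e 2 2 - 1 ≤ n →
    ∃ m ∈ AddSubgroup.closure {z : Literature.NumberTheory.Transcendental.KZ.FormalRep | ∃ (q : ℚ) (a : Fin 3 → ℕ) (e : Fin 3 → Fin 3 → ℤ) (s : Literature.NumberTheory.Transcendental.KZ.IntegralRep 3), (∀ i j i' j' : Fin 3, i < j → i' < j' → e i j ≠ 0 → e i' j' ≠ 0 → (i ≤ i' ∧ j' ≤ j) ∨ (i' ≤ i ∧ j ≤ j')) ∧ s.domain = {x : Fin 3 → ℝ | ∀ i, x i ∈ Set.Ioo (0:ℝ) 1} ∧ Set.EqOn s.integrand (fun x => (q : ℝ) * ((∏ i : Fin 3, x i ^ a i) * ∏ i : Fin 3, ∏ j : Fin 3, if i ≤ j then (1 - (∏ l : Fin 3, if i ≤ l ∧ l ≤ j then x l else 1)) ^ e i j else 1)) s.domain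 ∧ z = Literature.NumberTheory.Transcendental.KZ.of s}, Literature.NumberTheory.Transcendental.KZ.of s - m ∈ Literature.NumberTheory.Transcendental.KZ.relations := by
  intro n
  induction n with
  | zero =>
    intro a e s hdom hint h0 hn
    exact leaf_H1_three q hq a e s hdom hint (by omega)
  | succ n ih =>
    intro a e s hdom hint h0 hn
    by_cases h : (a 1 : ℤ) - a 2 - e 2 2 - 1 = 0
    · exact leaf_H1_three q hq a e s hdom hint (by omega)
    · obtain ⟨s₁, s₂, ⟨hd₁, hi₁⟩, ⟨hd₂, hi₂⟩, hrel⟩ := atomMove_s22 (q := q) ⟨hdom, hint⟩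
      obtain ⟨m₁, hm₁, h₁⟩ := ih (fun i => a i + (if i = 2 then 1 else 0)) e s₁ hd₁ hi₁
        (by simp; omega) (by simp; omega)
      obtain ⟨m₂, hm₂, h₂⟩ := ih a (fun i j => e i j + (if i = 2 ∧ j = 2 then 1 else 0)) s₂ hd₂ hi₂
        (by simp; omega) (by simp; omega)
      exact combine_pieces_three hrel hm₁ hm₂ h₁ h₂

/-- `g₄ ≤ 0`, `g₁ < 0`, `e₁₂ ≤ 0`: `x₁x₂ + y₁₂ = 1` raises `g₄` in one piece and `e₁₂` in the other,
down to `g₄ = 0` or `e₁₂ = 0`. [folklore] -/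
theorem unnest_three_D3 (q : ℚ) (hq : q ≠ 0) : ∀ (n : ℕ) (a : Fin 3 → ℕ) (e : Fin 3 → Fin 3 → ℤ)
    (s : KZ.IntegralRep 3),
    s.domain = {x : Fin 3 → ℝ | ∀ i, x i ∈ Set.Ioo (0:ℝ) 1} →
    Set.EqOn s.integrand (fun x => (q : ℝ) * atomFun a e x) s.domain →
    (a 1 : ℤ) - a 0 - e 0 0 - 1 ≤ 0 → (a 1 : ℤ) - a 2 - e 2 2 - 1 < 0 → e 1 2 ≤ 0 →
    -((a 1 : ℤ) - a 0 - e 0 0 - 1) - e 1 2 ≤ n →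
    ∃ m ∈ AddSubgroup.closure {z : Literature.NumberTheory.Transcendental.KZ.FormalRep | ∃ (q : ℚ) (a : Fin 3 → ℕ) (e : Fin 3 → Fin 3 → ℤ) (s : Literature.NumberTheory.Transcendental.KZ.IntegralRep 3), (∀ i j i' j' : Fin 3, i < j → i' < j' → e i j ≠ 0 → e i' j' ≠ 0 → (i ≤ i' ∧ j' ≤ j) ∨ (i' ≤ i ∧ j ≤ j')) ∧ s.domain = {x : Fin 3 → ℝ | ∀ i, x i ∈ Set.Ioo (0:ℝ) 1} ∧ Set.EqOn s.integrand (fun x => (q : ℝ) * ((∏ i : Fin 3, x i ^ a i) * ∏ i : Fin 3, ∏ j : Fin 3, if i ≤ j then (1 - (∏ l : Fin 3, if i ≤ l ∧ l ≤ j then x l else 1)) ^ e i j else 1)) s.domain ∧ z = Literature.NumberTheory.Transcendental.KZ.of s}, Literature.NumberTheory.Transcendental.KZ.of s - m ∈ Literature.NumberTheory.Transcendental.KZ.relations := by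
  intro n
  induction n with
  | zero =>
    intro a e s hdom hint h4 h1 h12 hn
    exact leaf_nested_three q a e s hdom hint (Or.inr (by omega))
  | succ n ih =>
    intro a e s hdom hint h4 h1 h12 hn
    by_cases hz4 : (a 1 : ℤ) - a 0 - e 0 0 - 1 = 0
    · exact leaf_H4_three q hq a e s hdom hint (by omega)
    by_cases hz12 : e 1 2 = 0
    · exact leaf_nested_three q a e s hdom hint (Or.inr hz12)
    obtain ⟨s₁, s₂, ⟨hd₁, hi₁⟩, ⟨hd₂, hi₂⟩, hrel⟩ := atomMove_s12 (q := q) ⟨hdom, hint⟩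
    obtain ⟨m₁, hm₁, h₁⟩ := ih (fun i => a i + (if i = 0 then 0 else 1)) e s₁ hd₁ hi₁
      (by simp; omega) (by simp; omega) h12 (by simp; omega)
    obtain ⟨m₂, hm₂, h₂⟩ := ih a (fun i j => e i j + (if i = 1 ∧ j = 2 then 1 else 0)) s₂ hd₂ hi₂
      (by simp; omega) (by simp; omega) (by simp; omega) (by simp; omega)
    exact combine_pieces_three hrel hm₁ hm₂ h₁ h₂

/-! ### All atoms -/

/-- **Unnesting in dimension three.** Every cube atom `[□³, q·atomFun a e]` with `q ≠ 0` is congruent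
modulo `KZ.relations` to an element of the closure of the nested dimension-three atoms. [folklore] -/
theorem unnest_three (q : ℚ) (hq : q ≠ 0) (a : Fin 3 → ℕ) (e : Fin 3 → Fin 3 → ℤ)
    (s : KZ.IntegralRep 3) (hdom : s.domain = {x : Fin 3 → ℝ | ∀ i, x i ∈ Set.Ioo (0:ℝ) 1})
    (hint : Set.EqOn s.integrand (fun x => (q : ℝ) * atomFun a e x) s.domain) :
    ∃ m ∈ AddSubgroup.closure {z : Literature.NumberTheory.Transcendental.KZ.FormalRep | ∃ (q : ℚ) (a : Fin 3 → ℕ) (e : Fin 3 → Fin 3 → ℤ) (s : Literature.NumberTheory.Transcendental.KZ.IntegralRep 3), (∀ i j i' j' : Fin 3, i < j → i' < j' → e i j ≠ 0 → e i' j' ≠ 0 → (i ≤ i' ∧ j' ≤ j) ∨ (i' ≤ i ∧ j ≤ j')) ∧ s.domain = {x : Fin 3 → ℝ | ∀ i, x i ∈ Set.Ioo (0:ℝ) 1} ∧ Set.EqOn s.integrand (fun x => (q : ℝ) * ((∏ i : Fin 3, x i ^ a i) * ∏ i : Fin 3, ∏ j : Fin 3, if i ≤ j then (1 - (∏ l :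 Fin 3, if i ≤ l ∧ l ≤ j then x l else 1)) ^ e i j else 1)) s.domain ∧ z = Literature.NumberTheory.Transcendental.KZ.of s}, Literature.NumberTheory.Transcendental.KZ.of s - m ∈ Literature.NumberTheory.Transcendental.KZ.relations := by
  by_cases hN : 0 ≤ e 0 1
  · exact unnest_three_N q ((e 0 1).toNat) a e s hdom hint hN (by omega)
  by_cases hN' : 0 ≤ e 1 2
  · exact unnest_three_N' q ((e 1 2).toNat) a e s hdom hint hN' (by omega)
  by_cases h4 : 0 ≤ (a 1 : ℤ) - a 0 - e 0 0 - 1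
  · exact unnest_three_D1 q hq ((a 1 : ℤ) - a 0 - e 0 0 - 1).toNat a e s hdom hint h4 (by omega)
  by_cases h1 : 0 ≤ (a 1 : ℤ) - a 2 - e 2 2 - 1
  · exact unnest_three_D2 q hq ((a 1 : ℤ) - a 2 - e 2 2 - 1).toNat a e s hdom hint h1 (by omega)
  exact unnest_three_D3 q hq (-((a 1 : ℤ) - a 0 - e 0 0 - 1) - e 1 2).toNat a e s hdom hint
    (by omega) (by omega) (by omega) (by omega)

/-- STUB `stub_unnesting_three`: the residual stub `stub_unnesting` of the line
`torus-descent-sum-shadow` in dimension `k = 3` — a non-nested cubical atom of dimension three is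
congruent modulo `KZ.relations` to an element of the closure of (nested ∪ SD1-directed ∪ word ∪
lower-dimensional) atoms; in fact of the nested ones alone (`unnest_three`).
[cite: KontsevichZagier2001, §1.2] -/
theorem stub_unnesting_three : ∀ (k : ℕ) (q : ℚ) (a : Fin k → ℕ) (e : Fin k → Fin k → ℤ) (s : Literature.NumberTheory.Transcendental.KZ.IntegralRep k), k = 3 → s.domain = {x : Fin k → ℝ | ∀ i, x i ∈ Set.Ioo (0:ℝ) 1} → Set.EqOn s.integrand (fun x => (q : ℝ) * ((∏ i : Fin k, x i ^ a i) * ∏ i : Fin k, ∏ j : Fin k, if i ≤ j then (1 - (∏ l : Fin k, if i ≤ l ∧ l ≤ j then x l else 1)) ^ e i j else 1)) s.domain → ¬ (∀ i j i' j' : Fin k, i < j → i' < j' → e i j ≠ 0 → e i' j' ≠ 0 → (i ≤ i' ∧ j' ≤ j) ∨ (i' ≤ i ∧ j ≤ j')) → ∃ m ∈ AddSubgroup.closure ({z : Literature.NumberTheory.Transcendental.KZ.FormalRep | ∃ (q : ℚ) (a : Fin k → ℕ) (e : Fin k → Fin k → ℤ) (s : Literature.NumberTheory.Transcendental.KZ.IntegralRep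 k), (∀ i j i' j' : Fin k, i < j → i' < j' → e i j ≠ 0 → e i' j' ≠ 0 → (i ≤ i' ∧ j' ≤ j) ∨ (i' ≤ i ∧ j ≤ j')) ∧ s.domain = {x : Fin k → ℝ | ∀ i, x i ∈ Set.Ioo (0:ℝ) 1} ∧ Set.EqOn s.integrand (fun x => (q : ℝ) * ((∏ i : Fin k, x i ^ a i) * ∏ i : Fin k, ∏ j : Fin k, if i ≤ j then (1 - (∏ l : Fin k, if i ≤ l ∧ l ≤ j then x l else 1)) ^ e i j else 1)) s.domain ∧ z = Literature.NumberTheory.Transcendental.KZ.of s} ∪ {z : Literature.NumberTheory.Transcendental.KZ.FormalRep | ∃ (q : ℚ) (a : Fin k → ℕ) (e : Fin k → Fin k → ℤ) (s : Literature.NumberTheory.Transcendental.KZ.IntegralRep k), (∃ lam : Fin k → ℤ, (∀ l : Fin k, lam l = 0 ∨ lam l = 1 ∨ lam l = -1) ∧ (∃ p : Fin k, lam p = -1) ∧ (Finset.univ.filter (fun l : Fin k => lam l = 1)).card ≤ 1 ∧ (∀ i j : Fin k, i ≤ j → e i j ≠ 0 → (∑ l : Fin k, if i ≤ l ∧ l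 ≤ j then lam l else 0) = 0) ∧ (∑ l : Fin k, lam l * ((a l : ℤ) + 1)) ≠ 0) ∧ s.domain = {x : Fin k → ℝ | ∀ i, x i ∈ Set.Ioo (0:ℝ) 1} ∧ Set.EqOn s.integrand (fun x => (q : ℝ) * ((∏ i : Fin k, x i ^ a i) * ∏ i : Fin k, ∏ j : Fin k, if i ≤ j then (1 - (∏ l : Fin k, if i ≤ l ∧ l ≤ j then x l else 1)) ^ e i j else 1)) s.domain ∧ z = Literature.NumberTheory.Transcendental.KZ.of s} ∪ {z : Literature.NumberTheory.Transcendental.KZ.FormalRep | ∃ (q : ℚ) (ε : Fin k → Bool) (s : Literature.NumberTheory.Transcendental.KZ.IntegralRep k), s.domain = {x : Fin k → ℝ | ∀ i, x i ∈ Set.Ioo (0:ℝ) 1} ∧ Set.EqOn s.integrand (fun x => (q : ℝ) * ((∏ i : Fin k, x i ^ (k - 1 - (i : ℕ))) * ∏ i : Fin k, if ε i then 1 / (1 - (∏ l : Fin k, if l ≤ i then x l else 1)) else 1 / (∏ l : Fin k, if l ≤ i then x l else 1))) s.domain ∧ z = Literature.NumberTheory.Transcendental.KZ.of s} ∪ {z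 : Literature.NumberTheory.Transcendental.KZ.FormalRep | ∃ d : ℕ, d < k ∧ z ∈ {z : Literature.NumberTheory.Transcendental.KZ.FormalRep | ∃ (q : ℚ) (a : Fin d → ℕ) (e : Fin d → Fin d → ℤ) (s : Literature.NumberTheory.Transcendental.KZ.IntegralRep d), s.domain = {x : Fin d → ℝ | ∀ i, x i ∈ Set.Ioo (0:ℝ) 1} ∧ Set.EqOn s.integrand (fun x => (q : ℝ) * ((∏ i : Fin d, x i ^ a i) * ∏ i : Fin d, ∏ j : Fin d, if i ≤ j then (1 - (∏ l : Fin d, if i ≤ l ∧ l ≤ j then x l else 1)) ^ e i j else 1)) s.domain ∧ z = Literature.NumberTheory.Transcendental.KZ.of s}}), Literature.NumberTheory.Transcendental.KZ.of s - m ∈ Literature.NumberTheory.Transcendental.KZ.relations := by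
  intro k q a e s hk hdom hint _
  subst hk
  have key : ∃ m ∈ AddSubgroup.closure {z : Literature.NumberTheory.Transcendental.KZ.FormalRep | ∃ (q : ℚ) (a : Fin 3 → ℕ) (e : Fin 3 → Fin 3 → ℤ) (s : Literature.NumberTheory.Transcendental.KZ.IntegralRep 3), (∀ i j i' j' : Fin 3, i < j → i' < j' → e i j ≠ 0 → e i' j' ≠ 0 → (i ≤ i' ∧ j' ≤ j) ∨ (i' ≤ i ∧ j ≤ j')) ∧ s.domain = {x : Fin 3 → ℝ | ∀ i, x i ∈ Set.Ioo (0:ℝ) 1} ∧ Set.EqOn s.integrand (fun x => (q : ℝ) * ((∏ i : Fin 3, x i ^ a i) * ∏ i : Fin 3, ∏ j : Fin 3, if i ≤ j then (1 - (∏ l : Fin 3, if i ≤ l ∧ l ≤ j then x l else 1)) ^ e i j else 1)) s.domain ∧ z = Literature.NumberTheory.Transcendental.KZ.of s}, Literature.NumberTheory.Transcendental.KZ.of s - m ∈ Literature.NumberTheory.Transcendental.KZ.relations := by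
    by_cases hq : q = 0
    · subst hq
      exact leaf_zero_three a e s hint
    · exact unnest_three q hq a e s hdom hint
  obtain ⟨m, hm, hrel⟩ := key
  exact ⟨m, AddSubgroup.closure_mono
    (Set.subset_union_left.trans (Set.subset_union_left.trans Set.subset_union_left)) hm, hrel⟩

/-! ### All dimensions `k ≤ 3` -/

/-- The residual stub `stub_unnesting` in every dimension `k ≤ 3`: vacuous for `k ≤ 2` (two chords of
length `≥ 2` are always comparable there), `stub_unnesting_three` for `k = 3`.
[cite: KontsevichZagier2001, §1.2] -/
theorem stub_unnesting_le_three : ∀ (k : ℕ) (q : ℚ) (a : Fin k → ℕ) (e : Fin k → Fin k → ℤ) (s : Literature.NumberTheory.Transcendental.KZ.IntegralRep k), k ≤ 3 → s.domain = {x : Fin k → ℝ | ∀ i, x i ∈ Set.Ioo (0:ℝ) 1} → Set.EqOn s.integrand (fun x => (q : ℝ) * ((∏ i : Fin k, x i ^ a i) * ∏ i : Fin k, ∏ j : Fin k, if i ≤ j then (1 - (∏ l : Fin k, if i ≤ l ∧ l ≤ j then x l else 1)) ^ e i j else 1)) s.domain → ¬ (∀ i j i' j' : Fin k, i < j → i'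 < j' → e i j ≠ 0 → e i' j' ≠ 0 → (i ≤ i' ∧ j' ≤ j) ∨ (i' ≤ i ∧ j ≤ j')) → ∃ m ∈ AddSubgroup.closure ({z : Literature.NumberTheory.Transcendental.KZ.FormalRep | ∃ (q : ℚ) (a : Fin k → ℕ) (e : Fin k → Fin k → ℤ) (s : Literature.NumberTheory.Transcendental.KZ.IntegralRep k), (∀ i j i' j' : Fin k, i < j → i' < j' → e i j ≠ 0 → e i' j' ≠ 0 → (i ≤ i' ∧ j' ≤ j) ∨ (i' ≤ i ∧ j ≤ j')) ∧ s.domain = {x : Fin k → ℝ | ∀ i, x i ∈ Set.Ioo (0:ℝ) 1} ∧ Set.EqOn s.integrand (fun x => (q : ℝ) * ((∏ i : Fin k, x i ^ a i) * ∏ i : Fin k, ∏ j : Fin k, if i ≤ j then (1 - (∏ l : Fin k, if i ≤ l ∧ l ≤ j then x l else 1)) ^ e i j else 1)) s.domain ∧ z = Literature.NumberTheory.Transcendental.KZ.of s} ∪ {z : Literature.NumberTheory.Transcendental.KZ.FormalRep | ∃ (q : ℚ) (a : Fin k → ℕ) (e : Fin k → Fin k → ℤ) (s : Literature.NumberTheory.Transcendental.KZ.IntegralRep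 k), (∃ lam : Fin k → ℤ, (∀ l : Fin k, lam l = 0 ∨ lam l = 1 ∨ lam l = -1) ∧ (∃ p : Fin k, lam p = -1) ∧ (Finset.univ.filter (fun l : Fin k => lam l = 1)).card ≤ 1 ∧ (∀ i j : Fin k, i ≤ j → e i j ≠ 0 → (∑ l : Fin k, if i ≤ l ∧ l ≤ j then lam l else 0) = 0) ∧ (∑ l : Fin k, lam l * ((a l : ℤ) + 1)) ≠ 0) ∧ s.domain = {x : Fin k → ℝ | ∀ i, x i ∈ Set.Ioo (0:ℝ) 1} ∧ Set.EqOn s.integrand (fun x => (q : ℝ) * ((∏ i : Fin k, x i ^ a i) * ∏ i : Fin k, ∏ j : Fin k, if i ≤ j then (1 - (∏ l : Fin k, if i ≤ l ∧ l ≤ j then x l else 1)) ^ e i j else 1)) s.domain ∧ z = Literature.NumberTheory.Transcendental.KZ.of s} ∪ {z : Literature.NumberTheory.Transcendental.KZ.FormalRep | ∃ (q : ℚ) (ε : Fin k → Bool) (s : Literature.NumberTheory.Transcendental.KZ.IntegralRep k), s.domain = {x : Fin k → ℝ | ∀ i, x i ∈ Set.Ioo (0:ℝ) 1} ∧ Set.EqOn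 s.integrand (fun x => (q : ℝ) * ((∏ i : Fin k, x i ^ (k - 1 - (i : ℕ))) * ∏ i : Fin k, if ε i then 1 / (1 - (∏ l : Fin k, if l ≤ i then x l else 1)) else 1 / (∏ l : Fin k, if l ≤ i then x l else 1))) s.domain ∧ z = Literature.NumberTheory.Transcendental.KZ.of s} ∪ {z : Literature.NumberTheory.Transcendental.KZ.FormalRep | ∃ d : ℕ, d < k ∧ z ∈ {z : Literature.NumberTheory.Transcendental.KZ.FormalRep | ∃ (q : ℚ) (a : Fin d → ℕ) (e : Fin d → Fin d → ℤ) (s : Literature.NumberTheory.Transcendental.KZ.IntegralRep d), s.domain = {x : Fin d → ℝ | ∀ i, x i ∈ Set.Ioo (0:ℝ) 1} ∧ Set.EqOn s.integrand (fun x => (q : ℝ) * ((∏ i : Fin d, x i ^ a i) * ∏ i : Fin d, ∏ j : Fin d, if i ≤ j then (1 - (∏ l : Fin d, if i ≤ l ∧ l ≤ j then x l else 1)) ^ e i j else 1)) s.domain ∧ z = Literature.NumberTheory.Transcendental.KZ.of s}}), Literature.NumberTheory.Transcendental.KZ.of s - m ∈ Literature.NumberTheory.Transcendental.KZ.relations :=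 by
  intro k q a e s hk hdom hint hnn
  interval_cases k
  · exact absurd (fun i => i.elim0) hnn
  · exfalso; apply hnn; intro i j i' j' hij
    fin_cases i; fin_cases j; simp at hij
  · exfalso; apply hnn; intro i j i' j' hij hij' _ _
    fin_cases i <;> fin_cases j <;> simp at hij
    fin_cases i' <;> fin_cases j' <;> simp at hij'
    decide
  · exact stub_unnesting_three 3 q a e s rfl hdom hint hnn

end Summit.KontsevichZagierPeriods.DihedralNormalForm.TorusDescent
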